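import Literature.NumberTheory.Automorphic.ReductionTheoryGLn
import Literature.NumberTheory.Automorphic.IdeleClassGroupCompactProofs
import Literature.NumberTheory.Automorphic.IdeleClassGroupProofs
import Mathlib.Topology.Instances.Matrix
import HarnessLib

/-!
# `M(𝔸_K)¹ = M(K) · C` with `C` compact, for the diagonal torus of `GL_n`

Topic `NumberTheory/Automorphic`. Let `K` be a number field, `𝔸_K` its adele ring, `J_K = 𝔸_Kˣ`
the ideles and `J_K¹` the norm-one ideles (`normOneIdeles K`, `IdeleClassGroup`). For the
diagonal Levi subgroup `M = T` of the upper triangular Borel subgroup of `GL_n`, the tree's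
`normOneDiagonal n K = M(𝔸_K)¹ ≤ GL_n(𝔸_K)` (`ReductionTheoryGLn`) is the group of diagonal
matrices with entries in `J_K¹`. We prove:

* `continuous_glDiagonal` — the diagonal embedding `(Rˣ)ⁿ →* GL_n(R)` (`glDiagonal` of
  `GLnAdelicStructure`) is continuous for the units topologies;
* `glDiagonal_principalIdele_mem_rationalPointsGL` — diagonal matrices of principal ideles are
  rational points (`rationalPointsGL` of `ReductionTheoryGLn`);
* `exists_isCompact_normOneDiagonal_adele` — **`M(K)¹ \ M(𝔸_K)¹` is compact, in fundamental-set
  form**: there is a compact `C ⊆ M(𝔸_K)¹` such that every `m ∈ M(𝔸_K)¹` is `m = δ · c` with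
  `δ` a diagonal matrix of principal ideles (so `δ ∈ GL_n(K)`) and `c ∈ C`. This is the
  coordinatewise form of the compactness of `J_K¹ / Kˣ` (Cassels–Fröhlich, Ch. II §16 Theorem;
  the tree's `exists_finset_normBox_of_ideleNorm_eq_one` of `NormOneIdeleClassCompact`: every
  norm-one idele is `t̃ · z · (k)` with `t` in a finite set of finite ideles, `z` in a compact box
  and `k ∈ Kˣ`).

Together with `UnipotentAdelicCompact` (`N(𝔸_K) = N(K) · C_N`) this provides the relatively
compact `Ω ⊆ N(𝔸_K) M(𝔸_K)¹` of a Siegel set `𝔖 = Ω · A_{T₀}(t) · K` modulo rational points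
(Getz–Hahn (2024), §2.7, (2.16) and Thm. 2.7.2, printed p. 48; the tree's `IsSiegelSetGL`,
`reductionTheory_gl`), i.e. the two compactness inputs "`[N]` compact" and "`M(F)\M(𝔸_F)¹`
compact" (op. cit. Thm. 2.6.2, the compactness criterion: `M(𝔸_F)¹ ⊇ M(F)` cocompact for the
torus `M = T`, whose split part has been divided out by passing to `M(𝔸)¹`).

## References

* J. W. S. Cassels, A. Fröhlich (eds.), *Algebraic Number Theory* (1967), Ch. II (Cassels,
  *Global fields*) §16 Theorem (`J_k¹/kˣ` compact) [CasselsFrohlichANT1967].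
* J. R. Getz, H. Hahn, *An Introduction to Automorphic Representations*, GTM 300 (2024), Thm. 2.6.2
  and §2.7, (2.16), Thm. 2.7.2, printed pp. 46–48 [GetzHahn2024].
-/

noncomputable section

open NumberField IsDedekindDomain Matrix

namespace Literature.NumberTheory.Automorphic

/-! ### Continuity of the diagonal embedding and rationality of principal diagonals -/

section Diagonal

variable {n : ℕ}

/-- The diagonal embedding `(Rˣ)ⁿ →* GL_n(R)`, `d ↦ diag(d)` (`glDiagonal`), is continuous for the
units topologies on `Rˣ` and `GL_n(R)` over a topological ring `R`: the matrix `diag(d)` and its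
inverse `diag(d⁻¹)` depend continuously on `(d, d⁻¹)`. [folklore] -/
theorem continuous_glDiagonal (R : Type*) [CommRing R] [TopologicalSpace R] [IsTopologicalRing R] :
    Continuous (glDiagonal n R) := by
  refine Units.continuous_iff.mpr ⟨?_, ?_⟩
  · have h : (Units.val ∘ glDiagonal n R) = fun d => Matrix.diagonal fun i => (d i : R) :=
      funext fun d => coe_glDiagonal n R d
    rw [h]
    exact (continuous_pi fun i => Units.continuous_val.comp (continuous_apply i)).matrix_diagonal
  · have h : (fun d => ((glDiagonal n R d)⁻¹ : GL (Fin n) R).val) =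
        fun d : Fin n → Rˣ => Matrix.diagonal fun i => ((d i)⁻¹ : Rˣ).val := by
      funext d
      rw [← map_inv, coe_glDiagonal]
      rfl
    rw [h]
    exact (continuous_pi fun i => Units.continuous_coe_inv.comp (continuous_apply i)).matrix_diagonal

variable (n) (K : Type) [Field K] [NumberField K]

/-- A diagonal matrix of principal ideles `diag((k₁), …, (kₙ))`, `kᵢ ∈ Kˣ`, is a rational point of
`GL_n(𝔸_K)`: it is the image of `diag(k) ∈ GL_n(K)` under the diagonal embedding
(`rationalPointsGL = range (GeneralLinearGroup.map (algebraMap K 𝔸_K))`). [folklore] -/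
theorem glDiagonal_principalIdele_mem_rationalPointsGL (k : Fin n → Kˣ) :
    glDiagonal n (AdeleRing (𝓞 K) K) (fun i => principalIdele K (k i)) ∈ rationalPointsGL n K := by
  refine ⟨glDiagonal n K k, Units.ext ?_⟩
  ext i j
  rw [Matrix.GeneralLinearGroup.map_apply, coe_glDiagonal, coe_glDiagonal, Matrix.diagonal_apply,
    Matrix.diagonal_apply]
  split_ifs
  · rfl
  · exact map_zero _

end Diagonal

/-! ### The fundamental set for `M(𝔸_K)¹` modulo `M(K)` -/

section Torus

variable (n : ℕ) (K : Type) [Field K] [NumberField K]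

/-- **`M(𝔸_K)¹ = M(K) · C` with `C` compact** (equivalently, `M(K) ∩ M(𝔸_K)¹ \ M(𝔸_K)¹ ≅ (J_K¹/Kˣ)ⁿ`
is compact), for the diagonal torus `M` of `GL_n`: there is a compact subset `C ⊆ M(𝔸_K)¹`
(`normOneDiagonal n K`) of `GL_n(𝔸_K)` such that every `m ∈ M(𝔸_K)¹` is `m = diag((k₁), …, (kₙ)) · c`
with `kᵢ ∈ Kˣ` and `c ∈ C`. Coordinatewise this is the compactness of `J_K¹/Kˣ` in fundamental-set
form (Cassels–Fröhlich (1967), Ch. II §16 Theorem; the tree's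
`exists_finset_normBox_of_ideleNorm_eq_one`: `x = t̃ · z · (k)` with `t ∈ T` finite, `z` in the
compact box `normBox`, `k ∈ Kˣ`); `C = diag(W₁ⁿ)` with `W₁ = (⋃_{t ∈ T} t̃ · B_t) ∩ J_K¹`, compact
as `J_K¹` is closed (`continuous_ideleNorm_holds`) and `glDiagonal` is continuous
(`continuous_glDiagonal`). This is the Levi half of the relatively compact part `Ω ⊆ N(𝔸) M(𝔸)¹`
of a Siegel set (Getz–Hahn (2024), (2.16), Thm. 2.7.2). [cite: CasselsFrohlichANT1967, Ch. II §16 Theorem] -/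
theorem exists_isCompact_normOneDiagonal_adele :
    ∃ C : Set (GL (Fin n) (AdeleRing (𝓞 K) K)), IsCompact C ∧
      C ⊆ normOneDiagonal n K ∧
      ∀ m ∈ normOneDiagonal n K, ∃ k : Fin n → Kˣ, ∃ c ∈ C,
        m = glDiagonal n (AdeleRing (𝓞 K) K) (fun i => principalIdele K (k i)) * c := by
  classical
  obtain ⟨T, R, R', hT⟩ := exists_finset_normBox_of_ideleNorm_eq_one K
  -- the compact set `W = ⋃_{t ∈ T} t̃ · B_t` of ideles and its norm-one part `W₁`
  set W : Set (AdeleRing (𝓞 K) K)ˣ := ⋃ t ∈ T, (fun z => finiteIdele K t * z) ''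
    normBox K (LangWave0.ideleNorm K (finiteIdele K t))⁻¹ (R t) (R' t) with hW
  have hWc : IsCompact W :=
    T.isCompact_biUnion fun t _ => (isCompact_normBox K _ _ _).image (continuous_const_mul _)
  set W₁ : Set (AdeleRing (𝓞 K) K)ˣ := W ∩ (normOneIdeles K : Set (AdeleRing (𝓞 K) K)ˣ) with hW₁
  have hclosed : IsClosed (normOneIdeles K : Set (AdeleRing (𝓞 K) K)ˣ) := by
    have h : (normOneIdeles K : Set (AdeleRing (𝓞 K) K)ˣ) = IdeleClassGroup.ideleNorm K ⁻¹' {1} := by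
      ext x; exact mem_normOneIdeles
    rw [h]
    exact isClosed_singleton.preimage (continuous_ideleNorm_holds K)
  have hW₁c : IsCompact W₁ := hWc.inter_right hclosed
  -- `C = diag(W₁ⁿ)`
  set box : Set (Fin n → (AdeleRing (𝓞 K) K)ˣ) := Set.univ.pi fun _ => W₁ with hbox
  refine ⟨glDiagonal n (AdeleRing (𝓞 K) K) '' box,
    (isCompact_univ_pi fun _ => hW₁c).image (continuous_glDiagonal (AdeleRing (𝓞 K) K)), ?_, ?_⟩
  · rintro _ ⟨d, hd, rfl⟩
    exact mem_normOneDiagonal_iff.mpr ⟨d, fun i => mem_normOneIdeles.mp (Set.mem_univ_pi.mp hd i).2, rfl⟩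
  · intro m hm
    obtain ⟨d, hd1, rfl⟩ := mem_normOneDiagonal_iff.mp hm
    have hlang : ∀ i, LangWave0.ideleNorm K (d i) = 1 := fun i =>
      (langIdeleNorm_eq_one_iff (d i)).mpr (mem_normOneIdeles.mpr (hd1 i))
    choose t ht k z hz hdeq using fun i => hT (d i) (hlang i)
    -- `d i = t̃ᵢ zᵢ (kᵢ)`; put `cᵢ = t̃ᵢ zᵢ = dᵢ (kᵢ)⁻¹ ∈ W₁`
    have hc1 : ∀ i, finiteIdele K (t i) * z i ∈ normOneIdeles K := by
      intro i
      have h : finiteIdele K (t i) * z i = d i * (principalIdele K (k i))⁻¹ :=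
        eq_mul_inv_of_mul_eq (hdeq i).symm
      rw [h]
      refine mul_mem (mem_normOneIdeles.mpr (hd1 i)) (inv_mem ?_)
      exact principalIdeles_le_normOneIdeles K
        ((principalUnits_eq_principalIdeles K) ▸ principalIdele_mem K (k i))
    refine ⟨k, glDiagonal n (AdeleRing (𝓞 K) K) fun i => finiteIdele K (t i) * z i,
      ⟨fun i => finiteIdele K (t i) * z i, Set.mem_univ_pi.mpr fun i => ⟨?_, hc1 i⟩, rfl⟩, ?_⟩
    · rw [hW]
      exact Set.mem_biUnion (ht i) ⟨z i, hz i, rfl⟩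
    · rw [← map_mul]
      congr 1
      funext i
      rw [Pi.mul_apply, hdeq i, mul_comm]

end Torus

end Literature.NumberTheory.Automorphic
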